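import Summits.ResolutionOfSingularities.ResolutionOfSingularities.Theorems.HilbertSamuelEliminationSigmaMaxModificationsCorridor3WLadderIsoTailsArcDivisibility
import HarnessLib

/-!
# [OURS · L1 W4.2 · D14 «K1 FREE-RATIONAL TAILS»] Strict transforms along the `t`-axis: the recursion `g_j(t, t y) = t^m g_{j+1}` gives
# `t^{nm} ∣ h(t, tⁿ y)`, hence (arc divisibility) `h ∈ (y₁, y₂, y₃)^m` (crux `SigmaMaxModifications` stmt-ResolutionOfSingularities-18506 /
# conjunct stmt-…-19249; kernel `IsoQuadraticTowerTerminates p 3`, card C5 K1)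

Lead prover res-L1-w42-lead-1 (gen 4), deal D14; sequel of `…Corridor3WLadderIsoTailsArcDivisibility`. Helper file `--supports
stmt-ResolutionOfSingularities-19249 --as helper`; kernel only, no definition of record, no named fact. OURS (cell res-hironaka, slot W4.2);
NOT statements of [Hironaka2017] nor of [CossartJannsenSaito2020] / [CossartPiltant2009]. AI-written; AI review is weaker than expert review.

## What is proved (every commutative ring `K`, every `m`; `K⟦t, y₁, y₂, y₃⟧`, Mathlib `MvPowerSeries.subst`)

* `Series.subst_chartSubstSeries_zero / _succ` — `h(t, t⁰y) = h`, `h(t, tⁿ⁺¹ y) = [h(t, tⁿ y)](t, t y)` (`subst_comp_subst`).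
* `Series.subst_chartSubstSeries_eq_of_strictTransforms` — if `g 0 = h` and `g_j(t, t y) = t^m · g_{j+1}(t, y)` for all `j` (each
  `g_{j+1}` the STRICT transform of `g_j` at the origin of the `t`-chart, for multiplicity `m`), then `h(t, tⁿ y) = t^{n m} · g_n`;
  `Series.X_pow_dvd_subst_chartSubstSeries_of_strictTransforms` — hence `t^{nm} ∣ h(t, tⁿ y)`, the hypothesis of `ArcDivisibilitySeries`.
* `Series.X_pow_dvd_subst_chartSubstSeries_one` — a series of order `≥ m` has first total transform divisible by `t^m` (its strict
  transform exists), so the recursion can be run as long as the order stays `≥ m`.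
* `Series.mem_pow_of_strictTransforms` — **THE ARC LEMMA IN STRICT-TRANSFORM FORM**: multiplicity `m` kept at ALL the infinitely near
  points of the arc `{y = 0}` (origins of the iterated `t`-charts) forces `h ∈ (y₁, y₂, y₃)^m`, i.e. the arc lies in the
  multiplicity-`m` locus — the algebraic heart of K1 `IsoFreeRationalTailsImpossible` (an eventually free-rational tail of an isolated
  point tower = the infinitely near points of one regular formal arc; isolation forbids the arc).

References: idea-1 card C5 (Sketch d9de4647629be5a3); V. Cossart, O. Piltant, J. Algebra 321 (2009) ch. 3 I.9 [CossartPiltant2009];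
V. Cossart, U. Jannsen, S. Saito, LNM 2270 (2020), proof of Lemma 11.5 [CossartJannsenSaito2020].
-/

noncomputable section

set_option linter.dupNamespace false -- mandated namespace of this single-conjunct summit

namespace Summit.ResolutionOfSingularities.ResolutionOfSingularities.Cruxes.SigmaMaxModifications.IdeasL1C5

universe u

namespace Series

open MvPowerSeries ArcDiv

variable {K : Type u} [CommRing K]

/-- The `0`-th chart substitution is the identity. [folklore] -/
theorem chartSubstSeries_zero : chartSubstSeries K 0 = MvPowerSeries.X := by
  funext i
  unfold chartSubstSeries
  split_ifs with h
  · rw [h]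
  · rw [pow_zero, one_mul]

/-- `h(t, t⁰ y) = h`. [folklore] -/
theorem subst_chartSubstSeries_zero (h : MvPowerSeries (Fin 4) K) : subst (chartSubstSeries K 0) h = h := by
  rw [chartSubstSeries_zero, subst_self]; rfl

/-- The `(n+1)`-st chart substitution is the `n`-th followed by the first: `h(t, tⁿ⁺¹ y) = [h(t, tⁿ y)](t, t y)`. [folklore] -/
theorem subst_chartSubstSeries_succ (n : ℕ) (h : MvPowerSeries (Fin 4) K) :
    subst (chartSubstSeries K (n + 1)) h = subst (chartSubstSeries K 1) (subst (chartSubstSeries K n) h) := by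
  rw [subst_comp_subst_apply (hasSubst_chartSubstSeries n) (hasSubst_chartSubstSeries 1)]
  congr 1
  funext i
  by_cases hi : i = 0
  · subst hi
    rw [chartSubstSeries_apply_zero, chartSubstSeries_apply_zero, subst_X (hasSubst_chartSubstSeries 1),
      chartSubstSeries_apply_zero]
  · rw [chartSubstSeries_apply_of_ne _ hi, chartSubstSeries_apply_of_ne _ hi,
      subst_mul (hasSubst_chartSubstSeries 1), subst_pow (hasSubst_chartSubstSeries 1),
      subst_X (hasSubst_chartSubstSeries 1), subst_X (hasSubst_chartSubstSeries 1),
      chartSubstSeries_apply_zero, chartSubstSeries_apply_of_ne _ hi]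
    ring

/-- **STRICT TRANSFORMS ALONG THE ARC GIVE THE ARC-DIVISIBILITY HYPOTHESIS.** If `g 0 = h` and each `g (j+1)` is the strict
transform of `g j` at the origin of the `t`-chart for multiplicity `m` — `g_j(t, t y) = t^m · g_{j+1}(t, y)` — then the `n`-th total
transform is `h(t, tⁿ y) = t^{n m} · g_n(t, y)`. [cite: CossartPiltant2009, ch. 3 I.9] -/
theorem subst_chartSubstSeries_eq_of_strictTransforms (h : MvPowerSeries (Fin 4) K) (m : ℕ)
    (g : ℕ → MvPowerSeries (Fin 4) K) (hg0 : g 0 = h)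
    (hstep : ∀ j, subst (chartSubstSeries K 1) (g j) = X 0 ^ m * g (j + 1)) :
    ∀ n, subst (chartSubstSeries K n) h = X 0 ^ (n * m) * g n := by
  intro n
  induction n with
  | zero => rw [subst_chartSubstSeries_zero, zero_mul, pow_zero, one_mul, hg0]
  | succ n ih =>
    rw [subst_chartSubstSeries_succ, ih, subst_mul (hasSubst_chartSubstSeries 1),
      subst_pow (hasSubst_chartSubstSeries 1), subst_X (hasSubst_chartSubstSeries 1), hstep n,
      chartSubstSeries_apply_zero, Nat.succ_mul, pow_add]
    ring

/-- Hence `t^{n m} ∣ h(t, tⁿ y)` for every `n` (the hypothesis of `ArcDivisibilitySeries`). [cite: CossartPiltant2009, ch. 3 I.9] -/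
theorem X_pow_dvd_subst_chartSubstSeries_of_strictTransforms (h : MvPowerSeries (Fin 4) K) (m : ℕ)
    (g : ℕ → MvPowerSeries (Fin 4) K) (hg0 : g 0 = h)
    (hstep : ∀ j, subst (chartSubstSeries K 1) (g j) = X 0 ^ m * g (j + 1)) (n : ℕ) :
    X 0 ^ (n * m) ∣ subst (chartSubstSeries K n) h :=
  ⟨g n, subst_chartSubstSeries_eq_of_strictTransforms h m g hg0 hstep n⟩

/-- **The first total transform of a series of order `≥ m` is divisible by `t^m`** — so its strict transform `g(t, t y)/t^m` exists
(the step equation of `subst_chartSubstSeries_eq_of_strictTransforms` can always be solved while the order stays `≥ m`). [folklore] -/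
theorem X_pow_dvd_subst_chartSubstSeries_one (m : ℕ) (g : MvPowerSeries (Fin 4) K)
    (hord : ∀ e, coeff e g ≠ 0 → m ≤ e 0 + yDeg e) : X 0 ^ m ∣ subst (chartSubstSeries K 1) g := by
  rw [X_pow_dvd_iff]
  intro e he
  rw [coeff_subst_chartSubstSeries]
  split_ifs with hle
  · by_contra hne
    have := hord _ hne
    simp only [yDeg, Finsupp.coe_tsub, Pi.sub_apply, Finsupp.single_apply, Fin.isValue, ↓reduceIte,
      show (0 : Fin 4) ≠ 2 by decide, show (0 : Fin 4) ≠ 3 by decide, tsub_zero] at this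
    simp only [yDeg, one_mul] at hle
    omega
  · rfl

/-- **THE ARC LEMMA IN STRICT-TRANSFORM FORM**: if the successive strict transforms `g_j` of `h = g_0` at the origins of the iterated
`t`-charts exist for the multiplicity `m` (`g_j(t, t y) = t^m g_{j+1}`), then `h ∈ (y₁, y₂, y₃)^m` — the arc `{y = 0}` lies in the
multiplicity-`m` locus of `h`. [cite: CossartPiltant2009, ch. 3 I.9] -/
theorem mem_pow_of_strictTransforms (h : MvPowerSeries (Fin 4) K) (m : ℕ) (g : ℕ → MvPowerSeries (Fin 4) K) (hg0 : g 0 = h)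
    (hstep : ∀ j, subst (chartSubstSeries K 1) (g j) = X 0 ^ m * g (j + 1)) :
    h ∈ (Ideal.span ({MvPowerSeries.X 1, MvPowerSeries.X 2, MvPowerSeries.X 3} : Set (MvPowerSeries (Fin 4) K))) ^ m :=
  mem_J_pow_of_forall_coeff m h fun _ he =>
    le_yDeg_of_dvd (X_pow_dvd_subst_chartSubstSeries_of_strictTransforms h m g hg0 hstep) he


end Series

end Summit.ResolutionOfSingularities.ResolutionOfSingularities.Cruxes.SigmaMaxModifications.IdeasL1C5

end
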